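import Literature.AlgebraicGeometry.Frobenioids.ModelFrobenioidDivision
import Literature.AlgebraicGeometry.Frobenioids.BaseFrobeniusSections
import Mathlib.CategoryTheory.Skeletal
import HarnessLib

/-!
# Frobenioids I, Theorem 5.2, proof (p. 101): the zero section of the model Frobenioid is a
# base-Frobenius pair (abc-iut cell, layer L1, node F-D1a — the proof's observation)

Mochizuki, *The geometry of Frobenioids I: the general theory*, Kyushu J. Math. **62** (2008)
293–400, §5, proof of Theorem 5.2, kurims text p. 101 [cite: MochizukiFrdI2008, Thm. 5.2 p.101]:

> "Here, we observe that the objects `A = (A_D, α)` such that `α = 0` are Frobenius-trivial, and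
> that these objects, together with the morphisms `φ = (deg_Fr(φ), Base(φ), Div(φ), u_φ) : A → B`
> such that `Div(φ) = 0`, `u_φ = 1` [i.e., `u_φ` is the identity element of `B(A)`], determine a
> base-Frobenius pair of `C`."

Rendering over Def. 2.7 (`BaseFrobeniusSections.lean`, seat abc-iut-L1-t2): the subcategory
`P ⊆ C` of the objects `(A_D, 0)` and the LINEAR morphisms `(1, f, 0, 1)` between them
(`zeroPresection`; a base-section lies in `C^pl-bk`, whose arrows are linear — the morphisms of higher
Frobenius degree with `Div = 0`, `u = 1` are the values of the Frobenius-section), and the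
homomorphism `n ↦ ((n, id, 0, 1))_A` (`zeroFrobeniusSection`). Def. 2.7 (i)(a) requires a
base-section to be a *skeleton*; the zero section over all of `D` is one exactly when `D` is
skeletal, which is how the observation is stated here (`Skeletal D`; cf. the proof of Thm. 5.2
(iv), "we may assume without loss of generality that `C` … is a skeleton") — for a general `D` one
restricts to a skeleton of `D`, which is not carried out in this file. Hypotheses otherwise as in
Thm. 5.2 (`Φ` divisorial, `B` group-like). No statement of the paper is strengthened.
-/

noncomputable section

namespace Literature.AlgebraicGeometry.Frobenioids

namespace ModelFrobenioid

open CategoryTheory Opposite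

universe w v u

variable {D : Type u} [Category.{v} D] {Φ B : Dᵒᵖ ⥤ CommMonCat.{w}} {DivB : B ⟶ monoidGp Φ}

/-! ### The zero section as a subcategory `P ⊆ C` -/

variable (Φ B DivB) in
/-- The subcategory `P`: objects `(A_D, 0)`, morphisms `(1, f, 0, 1)` (the linear ones among "the
morphisms such that `Div(φ) = 0`, `u_φ = 1`"). [cite: MochizukiFrdI2008, Thm. 5.2 p.101] -/
def zeroPresection : Presection (ModelFrobenioid Φ B DivB) where
  obj X := X.cls = 1
  hom {X Y} φ := X.cls = 1 ∧ Y.cls = 1 ∧ degFr φ = 1 ∧ div φ = 1 ∧ unit φ = 1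
  obj_of_hom _ h := ⟨h.1, h.2.1⟩
  hom_id h := ⟨h, h, rfl, rfl, rfl⟩
  hom_comp φ ψ hφ hψ := by
    refine ⟨hφ.1, hψ.2.1, ?_, ?_, ?_⟩
    · show degFr ψ * degFr φ = 1
      rw [hφ.2.2.1, hψ.2.2.1, mul_one]
    · rw [div_comp_pull, hψ.2.2.2.1, map_one, one_mul, hφ.2.2.2.1, one_pow]
    · rw [unit_comp_pull, hψ.2.2.2.2, map_one, one_mul, hφ.2.2.2.2, one_pow]

/-- The Frobenius endomorphism `(n, id, 0, 1)` of an object with `α = 0`.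
[cite: MochizukiFrdI2008, Thm. 5.2 p.101] -/
def zeroFrob (X : ModelFrobenioid Φ B DivB) (hX : X.cls = 1) (n : ℕ+) : X ⟶ X :=
  mkHom X X n (𝟙 _) 1 1 (by rw [hX]; simp only [one_pow, map_one, mul_one])

/-- The arrows of `P` commute with the Frobenius endomorphisms (naturality of `n ↦ (n, id, 0, 1)`).
[cite: MochizukiFrdI2008, Thm. 5.2 p.101] -/
theorem zeroFrob_naturality {X Y : ModelFrobenioid Φ B DivB} (φ : X ⟶ Y)
    (h : (zeroPresection Φ B DivB).hom φ) (n : ℕ+) :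
    φ ≫ zeroFrob Y h.2.1 n = zeroFrob X h.1 n ≫ φ := by
  obtain ⟨_, _, hd, hv, hu⟩ := h
  refine hom_ext ?_ ?_ ?_ ?_
  · show n * degFr φ = degFr φ * n
    rw [mul_comm]
  · show baseMap φ ≫ 𝟙 _ = 𝟙 _ ≫ baseMap φ
    rw [Category.comp_id, Category.id_comp]
  · show pull Φ (baseMap φ) 1 * div φ ^ (n : ℕ) = pull Φ (𝟙 _) (div φ) * (1 : Φ.obj (op X.base)) ^ (degFr φ : ℕ)
    simp only [hv, map_one, one_pow, mul_one]
  · show pull B (baseMap φ) 1 * unit φ ^ (n : ℕ) = pull B (𝟙 _) (unit φ) * (1 : B.obj (op X.base)) ^ (degFr φ : ℕ)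
    simp only [hu, map_one, one_pow, mul_one]

variable (Φ B DivB) in
/-- The Frobenius-section `F : N_{≥1} → End(P ↪ C)`, `n ↦ ((n, id, 0, 1)_A)_A`.
[cite: MochizukiFrdI2008, Thm. 5.2 p.101] -/
def zeroFrobeniusSection : ℕ+ →* End (zeroPresection Φ B DivB).ι where
  toFun n :=
    { app := fun A => zeroFrob ((zeroPresection Φ B DivB).ι.obj A) A.2 n
      naturality := fun _ _ f => zeroFrob_naturality f.1 f.2 n }
  map_one' := by
    apply NatTrans.ext
    funext A
    exact hom_ext rfl rfl rfl rfl
  map_mul' m n := by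
    apply NatTrans.ext
    funext A
    refine hom_ext rfl (Category.comp_id _).symm ?_ ?_
    · show (1 : Φ.obj (op ((zeroPresection Φ B DivB).ι.obj A).base)) = pull Φ (𝟙 _) 1 * 1 ^ (m : ℕ)
      rw [map_one, one_pow, mul_one]
    · show (1 : B.obj (op ((zeroPresection Φ B DivB).ι.obj A).base)) = pull B (𝟙 _) 1 * 1 ^ (m : ℕ)
      rw [map_one, one_pow, mul_one]

/-! ### The zero section is a base-Frobenius pair (for `D` skeletal) -/

/-- `P ↪ C → D` is faithful. [cite: MochizukiFrdI2008, Thm. 5.2 p.101] -/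
theorem zeroPresection_toBase_faithful :
    ((zeroPresection Φ B DivB).toBase (toElem Φ B DivB)).Faithful := by
  refine ⟨fun {X Y} {f g} h => ?_⟩
  have h' : baseMap f.1 = baseMap g.1 := h
  obtain ⟨_, _, hd, hv, hu⟩ := f.2
  obtain ⟨_, _, hd', hv', hu'⟩ := g.2
  exact Subtype.ext (hom_ext (hd.trans hd'.symm) h' (hv.trans hv'.symm) (hu.trans hu'.symm))

/-- `P ↪ C → D` is full: `f` lifts to `(1, f, 0, 1)`. [cite: MochizukiFrdI2008, Thm. 5.2 p.101] -/
theorem zeroPresection_toBase_full :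
    ((zeroPresection Φ B DivB).toBase (toElem Φ B DivB)).Full := by
  refine ⟨fun {X Y} d => ?_⟩
  let d₀ : X.1.base ⟶ Y.1.base := d
  have hX : X.1.cls = 1 := X.2
  have hY : Y.1.cls = 1 := Y.2
  refine ⟨⟨mkHom X.1 Y.1 1 d₀ 1 1 ?_, ⟨hX, hY, rfl, rfl, rfl⟩⟩, rfl⟩
  rw [hX, hY, one_pow, map_one, map_one, map_one, mul_one]

/-- `P ↪ C → D` is essentially surjective: `A_D` is the base of `(A_D, 0)`.
[cite: MochizukiFrdI2008, Thm. 5.2 p.101] -/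
theorem zeroPresection_toBase_essSurj :
    ((zeroPresection Φ B DivB).toBase (toElem Φ B DivB)).EssSurj :=
  ⟨fun A₀ => ⟨⟨zeroObj Φ B DivB A₀, rfl⟩, ⟨Iso.refl _⟩⟩⟩

/-- For `D` skeletal the zero section `P` is a skeleton. [cite: MochizukiFrdI2008, Thm. 5.2 p.101] -/
theorem zeroPresection_isSkeleton (hD : Skeletal D) : (zeroPresection Φ B DivB).IsSkeleton := by
  rintro ⟨⟨a, α⟩, hA⟩ ⟨⟨b, β⟩, hB⟩ ⟨e⟩
  have hα : α = 1 := hA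
  have hβ : β = 1 := hB
  have hab : a = b :=
    hD ⟨((zeroPresection Φ B DivB).toBase (toElem Φ B DivB)).mapIso e⟩
  subst hab
  subst hα
  subst hβ
  rfl

/-- **Proof of Thm. 5.2, observation (p. 101)**: for `D` skeletal, the zero section and its
Frobenius endomorphisms form a base-Frobenius pair of the model Frobenioid (Def. 2.7 (iii)).
[cite: MochizukiFrdI2008, Thm. 5.2 p.101] -/
theorem isBaseFrobeniusPair_zero (hΦd : Objectwise (fun M _ => IsDivisorial M) Φ)
    (hBg : Objectwise (fun M _ => IsGroupLike M) B) (hD : Skeletal D) :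
    PreFrobenioid.IsBaseFrobeniusPair (toElem Φ B DivB) (zeroPresection Φ B DivB)
      (zeroFrobeniusSection Φ B DivB) where
  isBaseSection :=
    { hom_pullback := fun _ h => isPullbackMorphism_of hΦd hBg h.2.2.1 h.2.2.2.1
      isSkeleton := zeroPresection_isSkeleton hD
      isFrobeniusTrivial := fun X hX => isFrobeniusTrivial_of_cls_eq_one hBg X hX
      isEquivalence := by
        haveI := zeroPresection_toBase_faithful (Φ := Φ) (B := B) (DivB := DivB)
        haveI := zeroPresection_toBase_full (Φ := Φ) (B := B) (DivB := DivB)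
        haveI := zeroPresection_toBase_essSurj (Φ := Φ) (B := B) (DivB := DivB)
        exact {} }
  isFrobeniusSection :=
    { degFr_eq := fun _ _ => rfl
      isBaseIdentity := fun _ _ => rfl
      isFrobeniusType := fun _ A => ⟨⟨isCoAngular hBg _, rfl⟩, show IsIso (𝟙 A.1.base) from inferInstance⟩ }

/-- Hence, for `D` skeletal, the model Frobenioid is of pre-model type (Def. 2.7 (iii)).
[cite: MochizukiFrdI2008, Thm. 5.2(ii) p.101] -/
theorem isOfPreModelType (hΦd : Objectwise (fun M _ => IsDivisorial M) Φ)
    (hBg : Objectwise (fun M _ => IsGroupLike M) B) (hD : Skeletal D) :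
    PreFrobenioid.IsOfPreModelType (toElem Φ B DivB) :=
  ⟨_, _, isBaseFrobeniusPair_zero hΦd hBg hD⟩

end ModelFrobenioid

end Literature.AlgebraicGeometry.Frobenioids
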